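import Summits.SmoothPoincare4.SmoothPoincare4.Theorems.EntropyRungNoncompactShrinkerGapStubModelValueSplitLine
import Literature.Geometry.Riemannian.ShrinkerPotentialGrowthProofs

/-!
# Stub `stub_modelValueSplitLine_of_nonneg` of line `collapsed-ends-usc` (crux
# `EntropyRung.NoncompactShrinkerGap`, stmt-SmoothPoincare4-10868): the model value on the split
# limit `N × ℝ`, with the growth fact weakened to (2.6)

This is the landed stub `NoncompactShrinkerGapModelValueSplitLine.stub_modelValueSplitLine` (U2,
file `EntropyRungNoncompactShrinkerGapStubModelValueSplitLine.lean`) with (i) its first antecedent,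
the named fact `shrinkerPotentialGrowth` (Haslhofer–Müller 2011, §2: (2.6), Lemma 2.1, Lemma 2.2),
WEAKENED to (2.6) alone — "on every complete connected normalised gradient shrinker of every
dimension, `R ≥ 0`" — and (ii) its second, unused antecedent `CarrilloNi2009_shrinkerLSI` dropped.
For a complete connected normalised 3-d gradient shrinker `(N, h, φ)` (`Ric_h + Hess φ = h/2`,
`R_h + |∇φ|² = φ`, closed `h`-balls compact) and every `ε > 0` there is a smooth compactly supported
`W` on `N × ℝ`, supported in `{φ < R} × (−R, R)`, with `∫ W² > 0`, whose Perelman functional on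
`(N × ℝ, dV_h ⊗ dt)` is `≤ log((4π)⁻² · 2√π ∫_N e^{-φ} dV_h) + ε`.

PROOF. The landed proof uses the growth fact only through `shrinkerWeights`, i.e. through
(a) `R ≥ 0`, (b) a minimum point `p` of `φ`, (c) the lower quadratic growth
`¼ (r − 5n)₊² ≤ φ(x)` for `r ≤ d(p, x)`. Given (2.6), (a) is the hypothesis at the shrinker at hand,
and (b), (c) are Haslhofer–Müller's Lemma 2.1, PROVED given (2.6) in
`Literature/Geometry/Riemannian/ShrinkerPotentialGrowthProofs.lean`
(`HaslhoferMuller.exists_forall_potential_le`,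
`HaslhoferMuller.potential_lower_of_scalarCurvature_nonneg`; the regularity instances of the smooth
Levi-Civita connection come from `isLocallyContMDiff_leviCivita_holds`, exactly as in
`HaslhoferMuller.shrinkerPotentialGrowth_of_nonneg_of_volume`). This gives
`shrinkerWeights_of_nonneg`; the rest is the landed argument verbatim (the profile `ρ`, the nine
factor integrals and their limits, `exists_index_of_limits`, the test function
`W_K(y,t) = ρ(φ/K)e^{-φ/2} · ρ(t²/4K)e^{-t²/8}`). Everything here is proved; no definition and no
named fact is introduced.

## References

* [HaslhoferMuller2011] R. Haslhofer, R. Müller, *A compactness theorem for complete Ricci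
  shrinkers*, GAFA 21 (2011) 1091–1116, §2: (2.6), Lemma 2.1.
* [CarrilloNi2009] J. A. Carrillo, L. Ni, *Sharp logarithmic Sobolev inequalities on gradient
  solitons and applications*, Comm. Anal. Geom. 17 (2009) 721–753, §4.
-/

noncomputable section

-- `Summit.SmoothPoincare4.SmoothPoincare4.…` (summit = problem) trips `dupNamespace` on every decl.
set_option linter.dupNamespace false

open scoped Manifold ContDiff ENNReal NNReal Topology
open MeasureTheory Set Filter
open Literature.Geometry.Lorentzian Literature.Geometry.Riemannian

namespace Summit.SmoothPoincare4.SmoothPoincare4.Theorems.NoncompactShrinkerGapModelValueSplitLineOfNonneg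

open Summit.SmoothPoincare4.SmoothPoincare4.Theorems.NoncompactShrinkerGapModelValueSplitLine

/-! ### The weights of a complete normalised shrinker, given (2.6) -/

section Shrinker

variable {n : ℕ} {N : Type} [TopologicalSpace N] [ChartedSpace (EuclideanSpace ℝ (Fin n)) N]
  [IsManifold (𝓡 n) ∞ N]
  {h : PseudoRiemannianMetric (𝓡 n) ∞ (EuclideanSpace ℝ (Fin n)) (TangentSpace (𝓡 n) : N → Type _)}
  {φ : N → ℝ}
  [T2Space N] [T3Space N] [MeasurableSpace N] [BorelSpace N] [h.HasLeviCivita]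

/-- **The weights of a complete connected normalised shrinker, given (2.6)**: if `R ≥ 0` on every
complete connected normalised gradient shrinker ((2.6), Haslhofer–Müller 2011 §2), then on a
complete connected gradient shrinker `Ric + Hess φ = h/2` normalised by `R + |∇φ|² = φ`:
`R ≥ 0`, `0 ≤ |∇φ|² ≤ φ`, `R ≤ φ`, `φ ≥ 0`, the potential is proper, and `e^{-φ}`, `φ e^{-φ}`,
`R e^{-φ}`, `|∇φ|² e^{-φ}` are integrable for `dV_h`. Proof: a minimum point `p` of `φ` and the
lower growth `¼(r − 5n)₊² ≤ φ` (`HaslhoferMuller.exists_forall_potential_le`,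
`HaslhoferMuller.potential_lower_of_scalarCurvature_nonneg`), then verbatim as
`NoncompactShrinkerGapModelValueSplitLine.shrinkerWeights` (`isCompact_sublevel_of_growth`,
Carrillo–Ni 2009 Cor. 2.1 as proved in `ShrinkerEntropyProofs.lean`). [folklore] -/
theorem shrinkerWeights_of_nonneg [SecondCountableTopology N] [ConnectedSpace N]
    (hX : ∀ (n : ℕ) (M : Type) [TopologicalSpace M] [T2Space M] [SecondCountableTopology M]
      [ChartedSpace (EuclideanSpace ℝ (Fin n)) M] [IsManifold (𝓡 n) ∞ M] [ConnectedSpace M]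
      [T3Space M] [MeasurableSpace M] [BorelSpace M]
      (g : PseudoRiemannianMetric (𝓡 n) ∞ (EuclideanSpace ℝ (Fin n)) (TangentSpace (𝓡 n) : M → Type _))
      [g.HasLeviCivita] (f : M → ℝ) (hg : g.IsRiemannian),
      (∀ (x : M) (r : NNReal), IsCompact {y : M | g.edist hg x y ≤ r}) →
      ContMDiff (𝓡 n) 𝓘(ℝ, ℝ) ∞ f →
      (∀ (x : M) (X Y : TangentSpace (𝓡 n) x),
        g.ricci x X Y + g.hessian f x X Y = (1 / 2 : ℝ) * g.val x X Y) →
      (∀ x : M, g.scalarCurvature x + g.gradSq f x = f x) →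
      ∀ x : M, 0 ≤ g.scalarCurvature x)
    (hh : h.IsRiemannian)
    (hc : ∀ (y : N) (r : NNReal), IsCompact {z : N | h.edist hh y z ≤ r})
    (hφ : ContMDiff (𝓡 n) 𝓘(ℝ, ℝ) ∞ φ)
    (hsol : ∀ (x : N) (X Y : TangentSpace (𝓡 n) x),
      h.ricci x X Y + h.hessian φ x X Y = (1 / 2 : ℝ) * h.val x X Y)
    (hnorm : ∀ x : N, h.scalarCurvature x + h.gradSq φ x = φ x) :
    (∀ x : N, 0 ≤ h.scalarCurvature x) ∧ (∀ x : N, 0 ≤ h.gradSq φ x) ∧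
    (∀ x : N, h.scalarCurvature x ≤ φ x) ∧ (∀ x : N, h.gradSq φ x ≤ φ x) ∧ (∀ x : N, 0 ≤ φ x) ∧
    (∀ R : ℝ, IsCompact {y : N | φ y ≤ R}) ∧
    Integrable (fun y ↦ Real.exp (-φ y)) h.riemVolume ∧
    Integrable (fun y ↦ φ y * Real.exp (-φ y)) h.riemVolume ∧
    Integrable (fun y ↦ h.scalarCurvature y * Real.exp (-φ y)) h.riemVolume ∧
    Integrable (fun y ↦ h.gradSq φ y * Real.exp (-φ y)) h.riemVolume := by
  /- (2.6) at the shrinker at hand -/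
  have hR0 : ∀ x : N, 0 ≤ h.scalarCurvature x := hX n N h φ hh hc hφ hsol hnorm
  have hG0 : ∀ x : N, 0 ≤ h.gradSq φ x := fun x ↦ h.gradSq_nonneg hh φ x
  have hRle : ∀ x : N, h.scalarCurvature x ≤ φ x := fun x ↦ by linarith [hnorm x, hG0 x]
  have hGle : ∀ x : N, h.gradSq φ x ≤ φ x := fun x ↦ by linarith [hnorm x, hR0 x]
  have hφ0 : ∀ x : N, 0 ≤ φ x := fun x ↦ (hR0 x).trans (hRle x)
  /- Haslhofer–Müller's Lemma 2.1 (minimum point and lower growth) given (2.6): the regularity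
  instances of the smooth Levi-Civita connection, as in
  `HaslhoferMuller.shrinkerPotentialGrowth_of_nonneg_of_volume` -/
  have hk1 : ((1 : ℕ∞) : ℕ∞ω) + 1 ≤ (∞ : ℕ∞ω) := by
    rw [show ((1 : ℕ∞) : ℕ∞ω) + 1 = 2 by norm_num]
    exact WithTop.coe_le_coe.2 le_top
  haveI : CovariantDerivative.ContMDiffCovariantDerivative h.leviCivita 1 :=
    ⟨h.isLocallyContMDiff_leviCivita_holds 1 hk1 univ isOpen_univ⟩
  haveI : CovariantDerivative.ContMDiffCovariantDerivative h.leviCivita ∞ :=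
    ⟨h.isLocallyContMDiff_leviCivita_holds ⊤ (le_of_eq rfl) univ isOpen_univ⟩
  obtain ⟨p, hp⟩ := HaslhoferMuller.exists_forall_potential_le h hh hc hφ hGle hsol
  have hlow : ∀ (x : N) (r : NNReal), (r : ℝ≥0∞) ≤ h.edist hh p x →
      (1 / 4 : ℝ) * (max ((r : ℝ) - 5 * n) 0) ^ 2 ≤ φ x := fun x r hr ↦ by
    have h' := HaslhoferMuller.potential_lower_of_scalarCurvature_nonneg h hh hc hφ hsol hnorm
      hR0 hp x r hr
    rwa [finrank_euclideanSpace_fin] at h'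
  /- properness and the weights, verbatim as `shrinkerWeights` -/
  have hprop : ∀ R : ℝ, IsCompact {y : N | φ y ≤ R} :=
    isCompact_sublevel_of_growth hh hc hφ.continuous hlow
  obtain ⟨hint, hfint⟩ :=
    CarrilloNi2009_shrinkerLSI.integrable_exp_neg_of_proper hh hφ hsol hnorm hprop
  obtain ⟨hRint, hgint⟩ := CarrilloNi2009_shrinkerLSI.integrable_gradSq_mul_exp_neg_of_proper hh hφ
    hsol hnorm hprop (B := 0) (fun x ↦ by simpa using hR0 x)
  exact ⟨hR0, hG0, hRle, hGle, hφ0, hprop, hint, hfint, hRint, hgint⟩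

end Shrinker

/-! ### The stub -/

/-- **Stub `stub_modelValueSplitLine_of_nonneg` of line `collapsed-ends-usc`** — the model value on
the split limit, given (2.6): if `R ≥ 0` on every complete connected normalised gradient shrinker,
then for a complete connected normalised 3-d gradient shrinker `(N, h, φ)` and `ε > 0` the cut-offs
`W_K(y,t) = ρ(φ/K)e^{-φ/2} · ρ(t²/4K)e^{-t²/8}` are smooth, compactly supported in
`{φ < 3K+1} × (−3K−1, 3K+1)`, have `∫ W_K² > 0`, and for `K` large their Perelman functional on
`(N × ℝ, dV_h ⊗ dt)` is `≤ log((4π)⁻² · 2√π ∫_N e^{-φ} dV_h) + ε`: the landed U2 stub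
`NoncompactShrinkerGapModelValueSplitLine.stub_modelValueSplitLine` with the growth fact
`shrinkerPotentialGrowth` weakened to (2.6) (`shrinkerWeights_of_nonneg`) and the unused antecedent
`CarrilloNi2009_shrinkerLSI` dropped (registered signature verbatim).
[cite: HaslhoferMuller2011, §2: (2.6), Lemmas 2.1–2.2] -/
theorem stub_modelValueSplitLine_of_nonneg : (∀ (n : ℕ) (M : Type) [TopologicalSpace M] [T2Space M] [SecondCountableTopology M] [ChartedSpace (EuclideanSpace ℝ (Fin n)) M] [IsManifold (𝓡 n) ∞ M] [ConnectedSpace M] [T3Space M] [MeasurableSpace M] [BorelSpace M] (g : PseudoRiemannianMetric (𝓡 n) ∞ (EuclideanSpace ℝ (Fin n)) (TangentSpace (𝓡 n) : M → Type _)) [g.HasLeviCivita] (f : M → ℝ) (hg : g.IsRiemannian), (∀ (x : M) (r : NNReal), IsCompact {y : M | g.edist hg x y ≤ r}) → ContMDiff (𝓡 n) 𝓘(ℝ, ℝ) ∞ f → (∀ (x : M) (X Y : TangentSpace (𝓡 n) x), g.ricci x X Y + g.hessian f x X Y = (1 / 2 : ℝ) * g.val x X Y) → (∀ x : M, g.scalarCurvature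 x + g.gradSq f x = f x) → ∀ x : M, 0 ≤ g.scalarCurvature x) → ∀ (N : Type) [TopologicalSpace N] [T2Space N] [SecondCountableTopology N] [ChartedSpace E3 N] [IsManifold (𝓡 3) ∞ N] [ConnectedSpace N] [T3Space N] [MeasurableSpace N] [BorelSpace N] (h : PseudoRiemannianMetric (𝓡 3) ∞ E3 (TangentSpace (𝓡 3) : N → Type _)) [h.HasLeviCivita] (φ : N → ℝ) (hh : h.IsRiemannian), (∀ (y : N) (r : NNReal), IsCompact {z : N | h.edist hh y z ≤ r}) → ContMDiff (𝓡 3) 𝓘(ℝ, ℝ) ∞ φ → (∀ (y : N) (X Y : TangentSpace (𝓡 3) y), h.ricci y X Y + h.hessian φ y X Y = (1 / 2 : ℝ) * h.val y X Y) → (∀ y : N, h.scalarCurvature y + h.gradSq φ y = φ y) → ∀ ε : ℝ, 0 < ε → ∃ (R : ℝ) (W : N × ℝ → ℝ), ContMDiff ((𝓡 3).prod 𝓘(ℝ, ℝ)) 𝓘(ℝ, ℝ) ∞ W ∧ HasCompactSupport W ∧ tsupport W ⊆ {y : N | φ y < R} ×ˢ Set.Ioo (-R) R ∧ 0 < ∫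 p, W p ^ 2 ∂(h.riemVolume.prod volume) ∧ (∫ p, (h.scalarCurvature p.1 * W p ^ 2 + 4 * (h.gradSq (fun y ↦ W (y, p.2)) p.1 + deriv (fun t ↦ W (p.1, t)) p.2 ^ 2) - W p ^ 2 * Real.log (W p ^ 2)) ∂(h.riemVolume.prod volume)) / (∫ p, W p ^ 2 ∂(h.riemVolume.prod volume)) + Real.log (∫ p, W p ^ 2 ∂(h.riemVolume.prod volume)) - Real.log ((4 * Real.pi) ^ 2) - 4 ≤ Real.log ((4 * Real.pi) ^ (-(4 : ℝ) / 2) * (2 * Real.sqrt Real.pi * ∫ y, Real.exp (-φ y) ∂h.riemVolume)) + ε := by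
  intro hX N _ _ _ _ _ _ _ _ _ h _ φ hh hc hφ hsol hnorm ε hε
  -- the profile, the weights (from (2.6)), Fubini
  obtain ⟨ρ, hs, h1, h0, h01, hd, C, hC0, hC⟩ := exists_profile
  obtain ⟨hR0, -, -, -, -, hprop, hint, hfint, hRint, hgint⟩ :=
    shrinkerWeights_of_nonneg hX hh hc hφ hsol hnorm
  haveI := sigmaFinite_riemVolume hh hprop
  have hφm : AEStronglyMeasurable φ h.riemVolume := hφ.continuous.aestronglyMeasurable
  have hψm : AEStronglyMeasurable (fun t : ℝ ↦ t ^ 2 / 4) volume :=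
    ((continuous_pow 2).div_const 4).aestronglyMeasurable
  -- the uncut values
  have hA : 0 < ∫ y, Real.exp (-φ y) ∂h.riemVolume := integral_exp_neg_pos hh hint
  have hB : 0 < 2 * Real.sqrt Real.pi := by positivity
  have hAφ : ∫ y, φ y * Real.exp (-φ y) ∂h.riemVolume =
      3 / 2 * ∫ y, Real.exp (-φ y) ∂h.riemVolume := by
    rw [integral_potential_mul_exp_neg hh hφ hsol hnorm hprop hR0]
    norm_num
  have hRG : (∫ y, h.scalarCurvature y * Real.exp (-φ y) ∂h.riemVolume) +
      ∫ y, h.gradSq φ y * Real.exp (-φ y) ∂h.riemVolume =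
      ∫ y, φ y * Real.exp (-φ y) ∂h.riemVolume := by
    rw [← integral_add hRint hgint]
    refine integral_congr_ae (Eventually.of_forall fun y ↦ ?_)
    show h.scalarCurvature y * Real.exp (-φ y) + h.gradSq φ y * Real.exp (-φ y) =
      φ y * Real.exp (-φ y)
    rw [← add_mul, hnorm y]
  have hBψ : Real.sqrt Real.pi = 2 * Real.sqrt Real.pi / 2 := by ring
  -- the nine limits along the cut-offs `K = k + 1`
  have L1 := tendsto_integral_profile_sq_mul hs h1 h01 hφm hint
  have L2 := tendsto_integral_profile_sq_mul hs h1 h01 hφm hRint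
  have L3 := tendsto_integral_profile_deriv_sq_mul hs h1 h01 hd hC0 hC hφm hgint
  have L4 := tendsto_integral_profile_sq_log_mul hs h1 h01 hφm hint
  have L5 := tendsto_integral_profile_sq_mul hs h1 h01 hφm hfint
  have L6 := tendsto_integral_profile_sq_mul hs h1 h01 hψm integrable_exp_neg_psi
  have L7 := tendsto_integral_profile_deriv_sq_mul hs h1 h01 hd hC0 hC hψm
    integrable_psi_mul_exp_neg_psi
  have L8 := tendsto_integral_profile_sq_log_mul hs h1 h01 hψm integrable_exp_neg_psi
  have L9 := tendsto_integral_profile_sq_mul hs h1 h01 hψm integrable_psi_mul_exp_neg_psi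
  rw [integral_exp_neg_psi] at L6
  rw [integral_psi_mul_exp_neg_psi] at L7 L9
  obtain ⟨k, hZk, hFk⟩ :=
    exists_index_of_limits hA hB hRG hAφ hBψ L1 L2 L3 L4 L5 L6 L7 L8 L9 hε
  -- the `ε`-good test function
  have hK : (1 : ℝ) ≤ (k : ℝ) + 1 := by simp
  obtain ⟨W, hW⟩ : ∃ W : N × ℝ → ℝ, W = fun p ↦ ρ (φ p.1 / ((k : ℝ) + 1)) *
      Real.exp (-φ p.1 / 2) * (ρ (p.2 ^ 2 / 4 / ((k : ℝ) + 1)) * Real.exp (-(p.2 ^ 2 / 4) / 2)) :=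
    ⟨_, rfl⟩
  obtain ⟨hWc, hWt⟩ := support_testFunction hφ.continuous hprop h0 hK hW
  refine ⟨3 * ((k : ℝ) + 1) + 1, W, contMDiff_testFunction hφ hs hW, hWc, hWt, ?_, ?_⟩
  · rw [integral_sq_testFunction hW]
    exact hZk
  · rw [integral_integrand_testFunction hφ hs h01 hC0 hC hK hint hfint hRint hgint hW,
      integral_sq_testFunction hW]
    exact hFk

end Summit.SmoothPoincare4.SmoothPoincare4.Theorems.NoncompactShrinkerGapModelValueSplitLineOfNonneg

end
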